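import Mathlib
import Literature.NumberTheory.LFunctions.Zhang2022.Section16BVarpiLocal
import Literature.NumberTheory.LFunctions.Zhang2022.Section16Lemma162RLocal
import Literature.NumberTheory.LFunctions.Zhang2022.AppendixALemma161Typed
import Literature.NumberTheory.Automorphic.AutomorphicLFunctionSplittingProofs
import Literature.Analysis.Complex.HolomorphicProducts
import HarnessLib

/-!
# Zhang (2022) §16 p. 93: the 2-part of `ϖ₂ⱼ` in closed form — `ϖ₂ⱼ(2^r)` against `𝓜₂*`
# (WP09-PLAN §10.3 item D-2 of Block D = Lemma 16.2, GAP row G-d57-1)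

Topic `Literature/NumberTheory/LFunctions/Zhang2022` (Landau–Siegel audit tree; verdict-neutral).
Y. Zhang, *Discrete mean estimates and the Landau–Siegel zero*, arXiv:2211.02515v1 (2022)
[Zhang2022LandauSiegel] — **an unrefereed manuscript under adjudication; nothing here asserts or
denies its Theorems 1–2 or anything about Landau–Siegel zeros.** ZHANG-L discharge lane, WP16
BLOCK D (Lemma 16.2, row G-d57-1), helper item D-2 of WP09-PLAN §10.3 (seat zl-w09-p6 for
zl-w09-p4 / zl-w16-p8 under the leaf `Typed.Section16B.Eq16_16`; signatures = the planner's
`SketchD2.lean`).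

§16 p. 93 (tex L4596–L4600): `ϖ₂ⱼ(n) = 𝓜₂*(1−β_j)⁻¹ Σ_{n=dl} λ₂(d,1−β_j)d^{β_j}χ(l)𝓜₂(d,l;1−β_j)`
(`Typed.Section16B.varpi2`), with `𝓜₂(d,l;s) = ∏_q F_q(d,l;s)` (`Section16A.calM2`,
`calM2Factor`) and `𝓜₂* = 𝓜₂(1,1;·)` if `χ(2) ≠ 1`, `= 2∏_{q≠2}F_q(1,1;·)` if `χ(2) = 1` (u025–u026,
`Section16A.calM2star`). The 2-SPLIT route to Lemma 16.2 (`ϖ₂ⱼ(2^r m) = ϖ₂ⱼ(2^r)ϖ₂ⱼ^loc(m)`) needs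
the factor at the prime `2` in closed form, in BOTH branches of `𝓜₂*`:

* `calM2_two_pow_mul_star` (D-2a, division-free, every `σ ≥ 9/10`):
  `𝓜₂(2^a,2^b;s)·F*₂(s) = F₂(2^a,2^b;s)·𝓜₂*(s)`, `F*₂ = F₂(1,1;s)` resp. `2` — by splitting the three
  Euler products at `{2}` (`Literature.NumberTheory.Automorphic.prod_mul_tprod_compl_of_multipliable`)
  and locality of `F_q(d,l;s)` in `(q ∣ d, q ∣ l)` (`calM2Factor_eq_one_one_of_coprime`);
* `varpi2_two_pow` (D-2b): `ϖ₂ⱼ(2^r) = (F*₂)⁻¹ Σ_{2^r = dl} λ₂(d)d^{β_j}χ(l)F₂(d,l;1−β_j)` given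
  `𝓜₂*(1−β_j) ≠ 0` and (`χ(2) ≠ 1 ⇒ F₂(1,1;1−β_j) ≠ 0`);
* `two_data_ne_zero` (D-2c): both non-vanishings for large `D` under (A), `j = 1, 2`
  (`AppendixA.lemma161_holds` ⇒ `Inline16_calM2starLarge`; and zl-w09-p4's
  `Lemma162R.half_le_norm_calM2Factor_one_one_small` at `q = 2`).

Theorem-only; no definitions, no new facts.

## References

* Y. Zhang, arXiv:2211.02515v1 (2022), §16 pp. 91–93 (tex L4537, L4566–L4572, L4596–L4600).
  [cite: Zhang2022LandauSiegel, §16 p.93 (u030)]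
-/

noncomputable section

open Complex Real Filter Topology

namespace Literature.NumberTheory.LFunctions.Zhang2022.Typed.Section16B

open Literature.NumberTheory.LFunctions.Zhang2022
open Literature.NumberTheory.LFunctions.Zhang2022.Skeleton
open Literature.NumberTheory.LFunctions.Zhang2022.Typed.Section16A

variable (c' : ℝ) {D : ℕ} (χ : DirichletCharacter ℂ D)

/-! ## D-2a: splitting the Euler products at the prime `2` -/

/-- A prime other than `2` is coprime to every power of `2`. [folklore] -/
private theorem coprime_two_pow_of_ne {q : Nat.Primes} (hq : (q : ℕ) ≠ 2) (a : ℕ) :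
    Nat.Coprime (q : ℕ) (2 ^ a) :=
  ((Nat.coprime_primes q.prop Nat.prime_two).mpr hq).pow_right a

/-- Off `{t}`, a point of the complement subtype is a prime `≠ t`. [folklore] -/
private theorem natCast_ne_of_mem_compl_singleton (t : Nat.Primes)
    (q : ↥((↑({t} : Finset Nat.Primes) : Set Nat.Primes)ᶜ)) :
    ((q : Nat.Primes) : ℕ) ≠ (t : ℕ) := by
  intro h
  have hq : (q : Nat.Primes) ∉ ((↑({t} : Finset Nat.Primes) : Set Nat.Primes)) := q.prop
  apply hq
  rw [Finset.mem_coe, Finset.mem_singleton]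
  exact Subtype.ext h

/-- The generic factors `F_q(1,1;s)` off any finite set of primes form a convergent product
(`σ ≥ 9/10`). [cite: Zhang2022LandauSiegel, §16 p.91 (u021)] -/
private theorem multipliable_compl_one_one (S : Finset Nat.Primes) {s : ℂ} (hs : 9 / 10 ≤ s.re) :
    Multipliable ((fun q : Nat.Primes => calM2Factor c' χ (q : ℕ) 1 1 s) ∘ (↑) :
      ↥((↑S : Set Nat.Primes)ᶜ) → ℂ) := by
  have hsum := (summable_norm_calM2Factor_one_one_sub_one c' χ hs).subtype ((↑S : Set Nat.Primes)ᶜ)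
  exact Literature.Analysis.Complex.multipliable_of_summable_norm_sub_one hsum

open scoped Classical in
/-- **D-2a** (§16 p. 93, the 2-part of u030; division-free, both branches of `𝓜₂*`, every `s` with
`σ ≥ 9/10`): `𝓜₂(2^a,2^b;s)·F*₂(s) = F₂(2^a,2^b;s)·𝓜₂*(s)` where `F*₂(s) = F₂(1,1;s)` if
`χ(2) ≠ 1` and `F*₂ = 2` if `χ(2) = 1`. [cite: Zhang2022LandauSiegel, §16 p.93 (u030)] -/
theorem calM2_two_pow_mul_star (a b : ℕ) {s : ℂ} (hs : 9 / 10 ≤ s.re) :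
    calM2 c' χ (2 ^ a) (2 ^ b) s * (if χ (2 : ZMod D) ≠ 1 then calM2Factor c' χ 2 1 1 s else 2) =
      calM2Factor c' χ 2 (2 ^ a) (2 ^ b) s * calM2star c' χ s := by
  have hs0 : 0 < s.re := by linarith
  set two : Nat.Primes := ⟨2, Nat.prime_two⟩ with htwo
  have htwo2 : (two : ℕ) = 2 := rfl
  set S : Finset Nat.Primes := {two} with hSdef
  set P : ℂ := ∏' q : ↥((↑S : Set Nat.Primes)ᶜ), calM2Factor c' χ ((q : Nat.Primes) : ℕ) 1 1 s
    with hPdef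
  -- locality off `2`
  have hloc : ∀ q : ↥((↑S : Set Nat.Primes)ᶜ),
      calM2Factor c' χ ((q : Nat.Primes) : ℕ) (2 ^ a) (2 ^ b) s =
        calM2Factor c' χ ((q : Nat.Primes) : ℕ) 1 1 s := by
    intro q
    have hq2 : ((q : Nat.Primes) : ℕ) ≠ 2 := natCast_ne_of_mem_compl_singleton two q
    exact calM2Factor_eq_one_one_of_coprime c' χ (q : Nat.Primes).prop
      (coprime_two_pow_of_ne hq2 a) (coprime_two_pow_of_ne hq2 b) hs0
  have hif : ∀ q : ↥((↑S : Set Nat.Primes)ᶜ),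
      (if ((q : Nat.Primes) : ℕ) = 2 then (1 : ℂ) else calM2Factor c' χ ((q : Nat.Primes) : ℕ) 1 1 s) =
        calM2Factor c' χ ((q : Nat.Primes) : ℕ) 1 1 s := by
    intro q
    rw [if_neg (natCast_ne_of_mem_compl_singleton two q)]
  -- multipliability on the complement, for the three integrands
  have hm11 := multipliable_compl_one_one c' χ S hs
  have hmab : Multipliable ((fun q : Nat.Primes => calM2Factor c' χ (q : ℕ) (2 ^ a) (2 ^ b) s) ∘ (↑) :
      ↥((↑S : Set Nat.Primes)ᶜ) → ℂ) :=
    hm11.congr fun q => (hloc q).symm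
  have hmif : Multipliable ((fun q : Nat.Primes =>
      if (q : ℕ) = 2 then (1 : ℂ) else calM2Factor c' χ (q : ℕ) 1 1 s) ∘ (↑) :
      ↥((↑S : Set Nat.Primes)ᶜ) → ℂ) :=
    hm11.congr fun q => (hif q).symm
  -- the three splittings
  have e1 : calM2 c' χ (2 ^ a) (2 ^ b) s = calM2Factor c' χ 2 (2 ^ a) (2 ^ b) s * P := by
    rw [calM2, ← Literature.NumberTheory.Automorphic.prod_mul_tprod_compl_of_multipliable S hmab,
      hSdef, Finset.prod_singleton]
    congr 1
    exact tprod_congr fun q => hloc q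
  have e2 : calM2 c' χ 1 1 s = calM2Factor c' χ 2 1 1 s * P := by
    rw [calM2, ← Literature.NumberTheory.Automorphic.prod_mul_tprod_compl_of_multipliable S hm11,
      hSdef, Finset.prod_singleton]
  have e3 : (∏' q : Nat.Primes, if (q : ℕ) = 2 then (1 : ℂ) else calM2Factor c' χ (q : ℕ) 1 1 s) =
      P := by
    rw [← Literature.NumberTheory.Automorphic.prod_mul_tprod_compl_of_multipliable S hmif,
      hSdef, Finset.prod_singleton]
    rw [if_pos htwo2, one_mul]
    exact tprod_congr fun q => hif q
  -- the two branches of `𝓜₂*`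
  by_cases h2 : χ (2 : ZMod D) ≠ 1
  · rw [if_pos h2, calM2star, if_pos h2, e1, e2]; ring
  · rw [if_neg h2, calM2star, if_neg h2, e1, e3]; ring

/-! ## D-2b: `ϖ₂ⱼ(2^r)` in closed form -/

/-- A point of the divisors antidiagonal of `2^r` is a pair of powers of `2`. [folklore] -/
private theorem exists_pow_of_mem_antidiag {r : ℕ} {x : ℕ × ℕ}
    (hx : x ∈ (2 ^ r).divisorsAntidiagonal) : ∃ a b : ℕ, x.1 = 2 ^ a ∧ x.2 = 2 ^ b := by
  have h := Nat.mem_divisorsAntidiagonal.mp hx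
  have h1 : x.1 ∣ 2 ^ r := ⟨x.2, h.1.symm⟩
  have h2 : x.2 ∣ 2 ^ r := ⟨x.1, by rw [mul_comm]; exact h.1.symm⟩
  obtain ⟨a, -, ha⟩ := (Nat.dvd_prime_pow Nat.prime_two).mp h1
  obtain ⟨b, -, hb⟩ := (Nat.dvd_prime_pow Nat.prime_two).mp h2
  exact ⟨a, b, ha, hb⟩

open scoped Classical in
/-- **D-2b** (§16 p. 93): `ϖ₂ⱼ(2^r) = (F*₂)⁻¹ · Σ_{2^r = dl} λ₂(d,1)d^{β_j}χ(l)F₂(d,l;1−β_j)`, given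
`𝓜₂*(1−β_j) ≠ 0` and (`χ(2) ≠ 1 ⇒ F₂(1,1;1−β_j) ≠ 0`), where `F*₂ = F₂(1,1;1−β_j)` resp. `2`.
[cite: Zhang2022LandauSiegel, §16 p.93 (u030)] -/
theorem varpi2_two_pow (j r : ℕ) (hstar : calM2star c' χ (1 - betaJ c' D j) ≠ 0)
    (hF : χ (2 : ZMod D) ≠ 1 → calM2Factor c' χ 2 1 1 (1 - betaJ c' D j) ≠ 0) :
    varpi2 c' χ j (2 ^ r) =
      (if χ (2 : ZMod D) ≠ 1 then calM2Factor c' χ 2 1 1 (1 - betaJ c' D j) else 2)⁻¹ *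
        ∑ x ∈ (2 ^ r).divisorsAntidiagonal,
          lam2 c' χ x.1 1 * (x.1 : ℂ) ^ betaJ c' D j * χ (x.2 : ZMod D) *
            calM2Factor c' χ 2 x.1 x.2 (1 - betaJ c' D j) := by
  set s : ℂ := 1 - betaJ c' D j with hs
  have hsre : 9 / 10 ≤ s.re := by
    rw [hs, Complex.sub_re, Complex.one_re, betaJ_re_eq_zero c' D j]; norm_num
  set Fst : ℂ := (if χ (2 : ZMod D) ≠ 1 then calM2Factor c' χ 2 1 1 s else 2) with hFst
  have hFst0 : Fst ≠ 0 := by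
    rw [hFst]
    split_ifs with h
    · exact hF h
    · exact two_ne_zero
  rw [varpi2, Finset.mul_sum]
  refine Finset.sum_congr rfl fun x hx => ?_
  obtain ⟨a, b, ha, hb⟩ := exists_pow_of_mem_antidiag hx
  have hsplit := calM2_two_pow_mul_star c' χ a b hsre
  rw [← ha, ← hb] at hsplit
  -- `calM2 x.1 x.2 s / 𝓜₂* = Fst⁻¹ · F₂(x.1,x.2;s)`
  have hquot : calM2 c' χ x.1 x.2 s / calM2star c' χ s = Fst⁻¹ * calM2Factor c' χ 2 x.1 x.2 s := by
    rw [← hFst] at hsplit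
    rw [div_eq_iff hstar]
    have e : calM2 c' χ x.1 x.2 s = calM2Factor c' χ 2 x.1 x.2 s * calM2star c' χ s / Fst := by
      rw [eq_div_iff hFst0]; exact hsplit
    rw [e]; field_simp
  rw [mul_div_assoc, hquot]
  ring

/-! ## D-2c: the two non-vanishings for large `D` -/

/-- `𝓛 ≥ M` once `D ≥ ⌈exp M⌉₊`. [cite: Zhang2022LandauSiegel, §2 (2.1)] -/
private theorem le_ell_of_ceil_exp_le_d2 {M : ℝ} {D : ℕ} (hD : ⌈Real.exp M⌉₊ ≤ D) : M ≤ ell D := by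
  have hDexp : Real.exp M ≤ D := le_trans (Nat.le_ceil _) (by exact_mod_cast hD)
  have hDpos : (0 : ℝ) < D := lt_of_lt_of_le (Real.exp_pos _) hDexp
  rw [ell]; exact (Real.le_log_iff_exp_le hDpos).mpr hDexp

omit χ in
/-- For `𝓛 ≥ 5π|c′| + 40`: `α ≤ 1/30000`, `|b₁| ≤ 2α`, `‖β₁‖, ‖β₂‖ ≤ 3α`. [cite: Zhang2022LandauSiegel, §2 (2.13)] -/
private theorem shifts_small (hℓ : 5 * π * |c'| + 40 ≤ ell D) :
    alpha D ≤ 1 / 30000 ∧ |b1 c' D| ≤ 2 * alpha D ∧ ‖beta1 c' D‖ ≤ 3 * alpha D ∧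
      ‖beta2 c' D‖ ≤ 3 * alpha D := by
  have hπ3 := Real.pi_gt_three
  have hπ4 := Real.pi_lt_four
  have hℓ40 : (40 : ℝ) ≤ ell D := by nlinarith [abs_nonneg c']
  have hℓ1 : 1 ≤ ell D := by linarith
  have hℓ0 : 0 < ell D := by linarith
  have hα : alpha D = π / ell D ^ 9 := by rw [alpha, bigP, Real.log_exp]
  have hα0 : 0 < alpha D := by rw [hα]; positivity
  have hℓ9 : ell D ^ 9 ≥ 40 ^ 8 * ell D := by
    have : ell D ^ 8 ≥ 40 ^ 8 := pow_le_pow_left₀ (by norm_num) hℓ40 8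
    nlinarith
  have hαsmall : alpha D ≤ 1 / 30000 := by
    rw [hα, div_le_iff₀ (by positivity)]
    nlinarith
  have hαℓ : alpha D * ell D = π / ell D ^ 8 := by rw [hα]; field_simp
  have hαℓ0 : 0 ≤ alpha D * ell D := by positivity
  have hcαℓ : |c'| * (alpha D * ell D) ≤ 1 / 5 := by
    rw [hαℓ]
    have h8 : ell D ≤ ell D ^ 8 := le_self_pow₀ hℓ1 (by norm_num)
    rw [← mul_div_assoc, div_le_iff₀ (by positivity)]
    nlinarith [abs_nonneg c', Real.pi_pos]
  have hc : |c' * (alpha D * ell D)| ≤ 1 / 5 := by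
    rw [abs_mul, abs_of_nonneg hαℓ0]; exact hcαℓ
  have hb1 : |b1 c' D| ≤ 2 * alpha D := by
    rw [b1, abs_mul, abs_of_pos hα0]
    have : |1 - 5 * c' * alpha D * ell D| ≤ 2 := by
      rw [abs_le]; constructor <;> nlinarith [abs_le.mp hc]
    nlinarith
  refine ⟨hαsmall, hb1, ?_, ?_⟩
  · have e : beta1 c' D = (((alpha D * (1 - 5 * c' * alpha D * ell D) : ℝ)) : ℂ) * I := by
      rw [beta1]; push_cast; ring
    rw [e, norm_mul, Complex.norm_I, mul_one, Complex.norm_real, Real.norm_eq_abs, abs_mul,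
      abs_of_pos hα0]
    have : |1 - 5 * c' * alpha D * ell D| ≤ 2 := by
      rw [abs_le]; constructor <;> nlinarith [abs_le.mp hc]
    nlinarith
  · have e : beta2 c' D = (((2 * alpha D * (1 + c' * alpha D * ell D) : ℝ)) : ℂ) * I := by
      rw [beta2]; push_cast; ring
    rw [e, norm_mul, Complex.norm_I, mul_one, Complex.norm_real, Real.norm_eq_abs, abs_mul,
      abs_of_pos (by positivity : (0:ℝ) < 2 * alpha D)]
    have : |1 + c' * alpha D * ell D| ≤ 3 / 2 := by
      rw [abs_le]; constructor <;> nlinarith [abs_le.mp hc]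
    nlinarith

/-- **D-2c** (§16 p. 93): for `D` large under (A) and `j ∈ {1,2}`, `𝓜₂*(1−β_j) ≠ 0`
(Lemma 16.1 ⇒ `|𝓜₂*| ≥ c > 0` on `|s−1| < 5α`, `AppendixA.lemma161_holds`; `‖β_j‖ ≤ 3α`) and, if
`χ(2) ≠ 1`, `F₂(1,1;1−β_j) ≠ 0` (`Lemma162R.half_le_norm_calM2Factor_one_one_small` at `q = 2`).
[cite: Zhang2022LandauSiegel, §16 p.93 (u030); Lemma 16.1 p.92] -/
theorem two_data_ne_zero : ForAllLarge fun D _ χ => AssumptionA D χ → ∀ j ∈ ({1, 2} : Finset ℕ),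
    calM2star c' χ (1 - betaJ c' D j) ≠ 0 ∧
      (χ (2 : ZMod D) ≠ 1 → calM2Factor c' χ 2 1 1 (1 - betaJ c' D j) ≠ 0) := by
  obtain ⟨c, hc, D₁, hD₁⟩ :=
    inline16_calM2starLarge_of_lemma161 c' (AppendixA.lemma161_holds c')
  refine ForAllLarge.of_le (max D₁ ⌈Real.exp (5 * π * |c'| + 40)⌉₊)
    fun D _ χ hD hq hprim hA j hj => ?_
  have hDD₁ : D₁ ≤ D := le_trans (le_max_left _ _) hD
  have hℓ : 5 * π * |c'| + 40 ≤ ell D := le_ell_of_ceil_exp_le_d2 (le_trans (le_max_right _ _) hD)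
  obtain ⟨hαs, hb1, hβ1, hβ2⟩ := shifts_small c' hℓ
  have hα : alpha D = π / ell D ^ 9 := by rw [alpha, bigP, Real.log_exp]
  have hπ3 := Real.pi_gt_three
  have hℓ40 : (40 : ℝ) ≤ ell D := by nlinarith [abs_nonneg c']
  have hα0 : 0 < alpha D := by rw [hα]; positivity
  have hj' : j = 1 ∨ j = 2 := by simpa using hj
  have hβj : ‖betaJ c' D j‖ ≤ 3 * alpha D := by
    rcases hj' with rfl | rfl
    · have e : betaJ c' D 1 = beta1 c' D := by simp [betaJ]
      rw [e]; exact hβ1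
    · have e : betaJ c' D 2 = beta2 c' D := by simp [betaJ]
      rw [e]; exact hβ2
  constructor
  · -- `𝓜₂*(1 − β_j) ≠ 0`
    have hs : ‖(1 - betaJ c' D j) - 1‖ < 5 * alpha D := by
      rw [sub_sub_cancel_left, norm_neg]; linarith
    have h := hD₁ D χ hDD₁ hq hprim hA (1 - betaJ c' D j) hs
    intro h0
    rw [h0, norm_zero] at h
    linarith
  · -- `F₂(1,1;1−β_j) ≠ 0` when `χ(2) ≠ 1`
    intro h2 h0
    have hb1' : |b1 c' D| ≤ 1 / 10000 := by linarith
    have hβj' : ‖betaJ c' D j‖ ≤ 1 / 10000 := by linarith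
    have h := Lemma162R.half_le_norm_calM2Factor_one_one_small c' χ Nat.prime_two (by norm_num)
      (fun _ => h2) hq hb1' hβj' (j := j)
    rw [h0, norm_zero] at h
    linarith


/-! ## D-2d: the absolute bound `‖ϖ₂ⱼ(2^e)‖ ≤ B(e+1)` (hypothesis (H2) of zl-w09-p4's `REuler`) -/

/-- The divisors antidiagonal of `2^e` has `e + 1` points. [folklore] -/
private theorem card_antidiag_two_pow (e : ℕ) : ((2 ^ e).divisorsAntidiagonal).card = e + 1 := by
  rw [← Nat.map_div_right_divisors, Finset.card_map, Nat.divisors_prime_pow Nat.prime_two,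
    Finset.card_map, Finset.card_range]

/-- **D-2d = (H2) with an ABSOLUTE constant** (§16 p. 93): there is `B` (`= 1056`) such that for
`D` large under (A), `j ∈ {1,2}` and every `e`, `‖ϖ₂ⱼ(2^e)‖ ≤ B(e+1)` — from the closed form D-2b:
`e+1` summands, each `|λ₂(2^a)|·|2^{aβ_j}|·|χ|·|F₂(2^a,2^b;1−β_j)| ≤ 3·1·1·176`, and `|F*₂⁻¹| ≤ 2`
(D-2c / zl-w09-p4's lower bound `1/2`). [cite: Zhang2022LandauSiegel, §16 p.93 (u030)] -/
theorem norm_varpi2_two_pow_le : ∃ B : ℝ, ForAllLarge fun D _ χ => AssumptionA D χ →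
    ∀ j ∈ ({1, 2} : Finset ℕ), ∀ e : ℕ, ‖varpi2 c' χ j (2 ^ e)‖ ≤ B * ((e : ℝ) + 1) := by
  classical
  obtain ⟨D₁, hD₁⟩ := two_data_ne_zero c'
  refine ⟨1056, ForAllLarge.of_le (max D₁ ⌈Real.exp (5 * π * |c'| + 40)⌉₊)
    fun D _ χ hD hq hprim hA j hj e => ?_⟩
  have hDD₁ : D₁ ≤ D := le_trans (le_max_left _ _) hD
  obtain ⟨hstar, hF⟩ := hD₁ D χ hDD₁ hq hprim hA j hj
  have hℓ : 5 * π * |c'| + 40 ≤ ell D := le_ell_of_ceil_exp_le_d2 (le_trans (le_max_right _ _) hD)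
  obtain ⟨hαs, hb1, hβ1, hβ2⟩ := shifts_small c' hℓ
  have hj' : j = 1 ∨ j = 2 := by simpa using hj
  have hβj : ‖betaJ c' D j‖ ≤ 3 * alpha D := by
    rcases hj' with rfl | rfl
    · have e1 : betaJ c' D 1 = beta1 c' D := by simp [betaJ]
      rw [e1]; exact hβ1
    · have e2 : betaJ c' D 2 = beta2 c' D := by simp [betaJ]
      rw [e2]; exact hβ2
  have hb1' : |b1 c' D| ≤ 1 / 10000 := by linarith
  have hβj' : ‖betaJ c' D j‖ ≤ 1 / 10000 := by linarith
  rw [varpi2_two_pow c' χ j e hstar hF, norm_mul]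
  -- `‖F*₂⁻¹‖·Σ ≤ 2·Σ_x 528`, termwise on the goal's own summands (no restatement)
  refine (mul_le_mul (b := (2 : ℝ)) ?_ (norm_sum_le_of_le (n := fun _ => (528 : ℝ)) _ fun x hx => ?_)
    (norm_nonneg _) (by norm_num : (0 : ℝ) ≤ 2)).trans (le_of_eq ?_)
  · -- `‖F*₂⁻¹‖ ≤ 2`
    rw [norm_inv]
    split_ifs with h2
    · have h := Lemma162R.half_le_norm_calM2Factor_one_one_small c' χ Nat.prime_two (by norm_num)
        (fun _ => h2) hq hb1' hβj' (j := j)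
      exact (inv_anti₀ (by norm_num) h).trans (by norm_num)
    · norm_num
  · -- one summand: `|λ₂(2^a)|·|2^{aβ_j}|·|χ|·|F₂| ≤ 3·1·1·176`
    obtain ⟨a, b, ha, hb⟩ := exists_pow_of_mem_antidiag hx
    rw [norm_mul, norm_mul, norm_mul]
    refine le_trans ?_ (by norm_num : (3 : ℝ) * 1 * 1 * 176 ≤ 528)
    refine mul_le_mul (mul_le_mul (mul_le_mul ?_ ?_ (norm_nonneg _) (by norm_num)) ?_
      (norm_nonneg _) (by norm_num)) ?_ (norm_nonneg _) (by norm_num)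
    · rw [ha, Lemma162R.lam2_prime_pow c' χ Nat.prime_two a 1]
      split_ifs
      · rw [norm_one]; norm_num
      · exact Section16ACalM2.norm_lam2_prime_one_le c' χ Nat.prime_two
    · rw [ha]; exact (Lemma162R.norm_prime_pow_cpow_betaJ c' Nat.prime_two a j).le
    · exact χ.norm_le_one _
    · refine (norm_le_norm_sub_add _ 1).trans ?_
      have h := Lemma162R.norm_calM2Factor_betaJ_sub_one_le c' χ Nat.prime_two x.1 x.2 j
      have h2 : (350 : ℝ) / (2 : ℕ) = 175 := by norm_num
      rw [norm_one]
      linarith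
  · rw [Finset.sum_const, card_antidiag_two_pow, nsmul_eq_mul]
    push_cast
    ring

end Literature.NumberTheory.LFunctions.Zhang2022.Typed.Section16B

end
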